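import Summits.BirchSwinnertonDyer.BirchSwinnertonDyer.Theorems.EisensteinDepletionAtTwoStarKummerDoorB
import Summits.BirchSwinnertonDyer.BirchSwinnertonDyer.Theses.EisensteinDepletionAtTwo

/-!
# Line `kummer` of crux `StarGO2Sigma` (stmt-BirchSwinnertonDyer-27046) — THE DOOR, part C: the compositions and the
# PRINT-CONDITIONAL END STATE (lead bsd-rank2-star-p1 GEN 13, 2026-08-28)

`starGO2SigmaLvl_of` (stubs 1–3 ⟹ (★-GO₂^Σ) at level `N = N_W`), `StarGO2Sigma_of` (the registered composition, verbatim), and the end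
state **`starGO2Sigma_of_prints : stub_levelEqConductor → stub_dedekindEtaLog → stub_maninPrint → stub_ubd → StarGO2Sigma`** — the
route item 27046 BY NAME from FOUR PRINTS and nothing else; `depletedLambdaLawAtTwoModNSF_of_prints` — the split parent 27021 from three
prints and the sibling child `StarOptBNSF` (27047, itself print-conditional: `NsfDoorPrint.starOptBNSF_of_print`).

HONEST FRAMING (Barrier B1): these files are the KERNEL GLUE of an OPEN crux made into tree theorems; the end state
`starGO2Sigma_of_prints` is CONDITIONAL on four PUBLISHED theorems that the tree holds only as named facts / print stubs
(Rademacher's `log η` law, Calegari–Dimitrov–Tang unbounded denominators, Carayol level = conductor, Edixhoven ∧ Abbes–Ullmo on the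
Manin constant).  Nothing here reads an analytic rank; `StarGO2Sigma` (27046), E1M_NSF (27021), E1M and BSD are NOT proved
(PARTITION D-0054: none — r_an ≥ 2, axis S0).
-/

set_option linter.dupNamespace false
set_option autoImplicit false

noncomputable section

namespace Summit.BirchSwinnertonDyer.BirchSwinnertonDyer.Theorems.DepletionAtTwo.KummerDoor

open scoped MatrixGroups ModularForm
open CongruenceSubgroup
open Literature.NumberTheory.EllipticCurves
open Literature.NumberTheory.EllipticCurves.Greenberg1999
open Literature.NumberTheory.EllipticCurves.ModularForms
open Literature.NumberTheory.ModularForms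
open Summit.BirchSwinnertonDyer.BirchSwinnertonDyer.Theorems.DepletionAtTwo
open scoped Manifold

/-- (★-GO₂^Σ) AT LEVEL = CONDUCTOR: the body of the route item `StarGO2Sigma` (27046) with the extra binder
`N = W.conductorNorm ℤ` after `IsOrdinaryAt W 2`.  This is the form the parent E1M_NSF consumes (its modularity clause
supplies the binder) and the form THEOREMS A+B address.
(By-name `Prop` handle of this file; no cite tag, not a Literature fact.) -/
def StarGO2SigmaLvl : Prop :=
  ∀ (W : WeierstrassCurve ℚ) [W.IsElliptic] [W.IsGloballyMinimal] (W₀ : WeierstrassCurve ℚ) [W₀.IsElliptic]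
    [W₀.IsGloballyMinimal] ⦃N : ℕ⦄ [NeZero N] (f : CuspForm (Gamma0 N) 2), IsNewformOf W f → IsNewformOf W₀ f →
    IsOrdinaryAt W 2 → N = W.conductorNorm ℤ →
    ∀ (L₀ : PeriodPair), IsNeronLatticeOf (W₀.baseChange ℂ) L₀ → ∀ (q : ℚ), q ≠ 0 →
    (∀ z ∈ periodLattice f, (q : ℂ) * z ∈ L₀.lattice) → (∀ z ∈ L₀.lattice, ∃ w ∈ periodLattice f, z = (q : ℂ) * w) →
    ∀ (x₀ : ℚ), HasRationalTwoTorsionX W₀ x₀ → ¬ TwoTorsionRamifiedAtTwo x₀ →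
    ∀ (lam : ℂ), lam ∈ L₀.lattice → lam / 2 ∉ L₀.lattice →
    L₀.weierstrassP (lam / 2) - ((W₀.b₂ : ℚ) : ℂ) / 12 = ((x₀ : ℚ) : ℂ) →
    (∃ β : ℕ → ℕ, IsAdmissibleStabData (W.conductorNorm ℤ) β) →
    ∃ β : ℕ → ℕ, IsAdmissibleStabData (W.conductorNorm ℤ) β ∧ ∃ g' : ℚ, g' ≠ 0 ∧ ∃ e : ℤ → ℤ,
      (∀ b d : ℤ, 0 < d → Int.gcd d (b * (W.conductorNorm ℤ : ℕ)) = 1 →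
        ∃ n' : ℤ, stabEisensteinPeriod (W.conductorNorm ℤ) β (Int.gcdA d (b * (W.conductorNorm ℤ : ℕ))) b
          (-((W.conductorNorm ℤ : ℕ) : ℤ) * Int.gcdB d (b * (W.conductorNorm ℤ : ℕ))) d = n' * g' ∧
        (Even n' ↔ ((∃ k : ℤ, ∃ w ∈ L₀.lattice,
          (q : ℂ) * (modularSymbol f ((b : ℚ) / (d : ℚ)) - modularSymbol f 0) = (k : ℂ) * lam + 2 * w) ↔ Even (e d)))) ∧
      (∃ b d : ℤ, 0 < d ∧ Int.gcd d (b * (W.conductorNorm ℤ : ℕ)) = 1 ∧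
        ∃ n' : ℤ, stabEisensteinPeriod (W.conductorNorm ℤ) β (Int.gcdA d (b * (W.conductorNorm ℤ : ℕ))) b
          (-((W.conductorNorm ℤ : ℕ) : ℤ) * Int.gcdB d (b * (W.conductorNorm ℤ : ℕ))) d = n' * g' ∧ Odd n')

/-! ### Small propositional lemmas -/

/-- `↔` is associative-commutative: the multiplicativity of a XNOR of two multiplicative parities. [folklore] -/
theorem discrepancy_mul_aux {a b : ℤ} {Pa Pb Pab : Prop} (hP : Pab ↔ (Pa ↔ Pb)) :
    (Even (a + b) ↔ Pab) ↔ ((Even a ↔ Pa) ↔ (Even b ↔ Pb)) := by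
  rw [Int.even_add]
  tauto
/-- Re-association of `↔`. [folklore] -/
theorem iff_rotate_aux {A B C : Prop} (h : (A ↔ B) ↔ C) : A ↔ (B ↔ C) := by
  tauto

/-- COMPOSITION (kernel-checked): stubs 1–3 give (★-GO₂^Σ) at level `N = N_W`.  The discrepancy
`D γ := (φ_β(γ)/g' even ↔ q·cuspSymbol f γ ∈ ℤλ + 2Λ_{W₀})` is multiplicative on `Γ₀(N)` (stub 1 (i) + TREE
`stabEisensteinPeriod_mul` + stub 2) and holds on `Γ₁(N)` (stub 1 (ii)), so it is `Even (e d)` (stub 3); at the Bézout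
matrix `γ_{b,d}` this is the cusp clause (TREE `modularSymbol_gamma0_smul_holds` at `r = 0`). [cite: Stevens1982, §2.5]
[cite: Manin1972, §1.5–1.7] -/
theorem starGO2SigmaLvl_of :
    stub_gammaOneParity → StarGO2SigmaLvl := by
  intro hP W _ _ W₀ _ _ N _ f hf hf₀ hord hN L₀ hL₀ q hq hin hout x₀ hx₀ hnr lam hlam hlam2 h℘ hβ
  have h1 : GammaOneLaw := gammaOneLaw_of hP
  have h3 : stub_kummerParityHom := KummerStubs.stub_kummerParityHom
  have h2 : stub_characterOfGamma0 := KummerStubs.stub_characterOfGamma0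
  dsimp only [GammaOneLaw, stub_kummerParityHom, stub_characterOfGamma0] at h1 h3 h2
  obtain ⟨β, hadm, g', hg', hint, hlaw, hodd⟩ :=
    h1 W W₀ f hf hf₀ hord hN L₀ hL₀ q hq hin hout x₀ hx₀ hnr lam hlam hlam2 h℘ hβ
  refine ⟨β, hadm, g', hg', ?_⟩
  subst hN
  -- opaque names for the Eisenstein value, the symbol parity and the discrepancy
  obtain ⟨φ, hφ⟩ : ∃ φ : Gamma0 (W.conductorNorm ℤ) → ℚ, ∀ γ, φ γ =
      stabEisensteinPeriod (W.conductorNorm ℤ) β ((γ : SL(2, ℤ)) 0 0) ((γ : SL(2, ℤ)) 0 1) ((γ : SL(2, ℤ)) 1 0) ((γ : SL(2, ℤ)) 1 1) :=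
    ⟨_, fun _ ↦ rfl⟩
  obtain ⟨P, hP⟩ : ∃ P : Gamma0 (W.conductorNorm ℤ) → Prop, ∀ γ, P γ ↔
      ∃ k : ℤ, ∃ w ∈ L₀.lattice, (q : ℂ) * cuspSymbol f γ = (k : ℂ) * lam + 2 * w :=
    ⟨_, fun _ ↦ Iff.rfl⟩
  obtain ⟨D, hDdef⟩ : ∃ D : Gamma0 (W.conductorNorm ℤ) → Prop, ∀ γ, D γ ↔ ∃ n : ℤ, φ γ = n * g' ∧ (Even n ↔ P γ) :=
    ⟨_, fun _ ↦ Iff.rfl⟩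
  have hint' : ∀ γ : Gamma0 (W.conductorNorm ℤ), ∃ n : ℤ, φ γ = n * g' := fun γ ↦ by rw [hφ]; exact hint γ
  have hlaw' : ∀ γ : Gamma0 (W.conductorNorm ℤ), ((W.conductorNorm ℤ : ℕ) : ℤ) ∣ (γ : SL(2, ℤ)) 1 1 - 1 → ∀ n : ℤ, φ γ = n * g' → (Even n ↔ P γ) := by
    intro γ hγ n hn
    rw [hP]
    rw [hφ] at hn
    exact hlaw γ hγ n hn
  have hD : ∀ (γ : Gamma0 (W.conductorNorm ℤ)) (n₀ : ℤ), φ γ = n₀ * g' → (D γ ↔ (Even n₀ ↔ P γ)) := by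
    intro γ n₀ h0
    rw [hDdef]
    constructor
    · rintro ⟨n, hn, hiff⟩
      have hnn : (n : ℚ) = n₀ := mul_right_cancel₀ hg' (hn.symm.trans h0)
      have hnn' : n = n₀ := by exact_mod_cast hnn
      rw [← hnn']
      exact hiff
    · intro hiff
      exact ⟨n₀, h0, hiff⟩
  -- additivity of the Eisenstein side on Γ₀(N) (TREE)
  have hN0 : W.conductorNorm ℤ ≠ 0 := NeZero.ne _
  have hmemN : ∀ γ : Gamma0 (W.conductorNorm ℤ), ((W.conductorNorm ℤ : ℕ) : ℤ) ∣ (γ : SL(2, ℤ)) 1 0 := fun γ ↦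
    (ZMod.intCast_zmod_eq_zero_iff_dvd _ _).mp (Gamma0_mem.mp γ.2)
  have hadd : ∀ γ δ : Gamma0 (W.conductorNorm ℤ), φ (γ * δ) = φ γ + φ δ := by
    intro γ δ
    rw [hφ, hφ, hφ, Subgroup.coe_mul]
    exact stabEisensteinPeriod_mul hN0 hadm (hmemN γ) (hmemN δ)
  -- multiplicativity of the symbol parity (stub 2) and of the discrepancy
  have hPmul : ∀ γ δ : Gamma0 (W.conductorNorm ℤ), P (γ * δ) ↔ (P γ ↔ P δ) := by
    intro γ δ
    rw [hP, hP, hP]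
    exact h3 f L₀ q hin lam hlam hlam2 γ δ
  have hDmul : ∀ γ δ : Gamma0 (W.conductorNorm ℤ), D (γ * δ) ↔ (D γ ↔ D δ) := by
    intro γ δ
    obtain ⟨a, ha⟩ := hint' γ
    obtain ⟨b, hb⟩ := hint' δ
    have hab : φ (γ * δ) = ((a + b : ℤ) : ℚ) * g' := by
      rw [hadd, ha, hb]
      push_cast
      ring
    rw [hD _ _ hab, hD _ _ ha, hD _ _ hb]
    exact discrepancy_mul_aux (hPmul γ δ)
  have hDone : ∀ γ : Gamma0 (W.conductorNorm ℤ), ((W.conductorNorm ℤ : ℕ) : ℤ) ∣ (γ : SL(2, ℤ)) 1 1 - 1 → D γ := by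
    intro γ hγ
    obtain ⟨n, hn⟩ := hint' γ
    exact (hD γ n hn).mpr (hlaw' γ hγ n hn)
  -- the character (stub 3)
  obtain ⟨e, he⟩ := h2 (W.conductorNorm ℤ) D hDmul hDone
  refine ⟨e, ?_, hodd⟩
  intro b d hd hgcd
  -- the Bézout matrix of the cusp b/d as an element of Γ₀(N)
  have hbez : ((Int.gcd d (b * (W.conductorNorm ℤ : ℕ)) : ℕ) : ℤ) =
      d * Int.gcdA d (b * (W.conductorNorm ℤ : ℕ)) + b * (W.conductorNorm ℤ : ℕ) * Int.gcdB d (b * (W.conductorNorm ℤ : ℕ)) :=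
    Int.gcd_eq_gcd_ab d (b * (W.conductorNorm ℤ : ℕ))
  rw [hgcd] at hbez
  push_cast at hbez
  have hdet : Matrix.det !![Int.gcdA d (b * (W.conductorNorm ℤ : ℕ)), b; -((W.conductorNorm ℤ : ℕ) : ℤ) * Int.gcdB d (b * (W.conductorNorm ℤ : ℕ)), d] = 1 := by
    rw [Matrix.det_fin_two_of]
    linear_combination -hbez
  set M : SL(2, ℤ) := ⟨!![Int.gcdA d (b * (W.conductorNorm ℤ : ℕ)), b; -((W.conductorNorm ℤ : ℕ) : ℤ) * Int.gcdB d (b * (W.conductorNorm ℤ : ℕ)), d], hdet⟩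
    with hM
  have e00 : M 0 0 = Int.gcdA d (b * (W.conductorNorm ℤ : ℕ)) := rfl
  have e01 : M 0 1 = b := rfl
  have e10 : M 1 0 = -((W.conductorNorm ℤ : ℕ) : ℤ) * Int.gcdB d (b * (W.conductorNorm ℤ : ℕ)) := rfl
  have e11 : M 1 1 = d := rfl
  have hMmem : M ∈ Gamma0 (W.conductorNorm ℤ) := by
    rw [Gamma0_mem, ZMod.intCast_zmod_eq_zero_iff_dvd, e10]
    exact ⟨-Int.gcdB d (b * (W.conductorNorm ℤ : ℕ)), by ring⟩
  set γ₀ : Gamma0 (W.conductorNorm ℤ) := ⟨M, hMmem⟩ with hγ₀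
  have hcoe : (γ₀ : SL(2, ℤ)) = M := rfl
  -- the Eisenstein value at γ₀
  obtain ⟨n', hn'⟩ := hint' γ₀
  have hn'' : stabEisensteinPeriod (W.conductorNorm ℤ) β (Int.gcdA d (b * (W.conductorNorm ℤ : ℕ))) b (-((W.conductorNorm ℤ : ℕ) : ℤ) * Int.gcdB d (b * (W.conductorNorm ℤ : ℕ))) d =
      n' * g' := by
    have h := hn'
    rw [hφ, hcoe, e00, e01, e10, e11] at h
    exact h
  refine ⟨n', hn'', ?_⟩
  -- the symbol value at γ₀ : cuspSymbol f γ₀ = {∞, b/d} - {∞, 0}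
  have hr : (((γ₀ : SL(2, ℤ)) 1 0 : ℤ) : ℚ) * 0 + (((γ₀ : SL(2, ℤ)) 1 1 : ℤ) : ℚ) ≠ 0 := by
    rw [hcoe, e11, mul_zero, zero_add]
    exact_mod_cast hd.ne'
  have hsm := modularSymbol_gamma0_smul_holds f γ₀ 0 hr
  rw [hcoe, e00, e01, e10, e11, mul_zero, zero_add, mul_zero, zero_add] at hsm
  have hcs : cuspSymbol f γ₀ = modularSymbol f ((b : ℚ) / (d : ℚ)) - modularSymbol f 0 := by
    rw [hsm]
    ring
  -- assemble
  have key : (Even n' ↔ P γ₀) ↔ Even (e d) := by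
    rw [← hD γ₀ n' hn']
    have h := he γ₀
    rw [hcoe, e11] at h
    exact h
  rw [hP, hcs] at key
  exact iff_rotate_aux key

/-- COMPOSITION (kernel-checked, no sorry; v7: seven stubs): the stubs give the route item `StarGO2Sigma` (27046) BY NAME.
[cite: Stevens1982, §2.5] [cite: Carayol1986, Thm. (A)] -/
theorem StarGO2Sigma_of :
    stub_levelEqConductor → stub_dedekindEtaLog → stub_etaSqrt →
    stub_maninPrint → stub_ubd →
    Summit.BirchSwinnertonDyer.BirchSwinnertonDyer.Theses.EisensteinDepletionAtTwo.StarGO2Sigma := by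
  intro h4 hKD hKU hMP hU W _ _ W₀ _ _ N _ f hf hf₀ hord L₀ hL₀ q hq hin hout x₀ hx₀ hnr lam hlam hlam2 h℘ hβ
  have hKT : stub_etaKummerTheta := Holds.stub_etaKummerTheta
  have hD : stub_discrepancyCover := discrepancyCover_of hKD hKU hKT hMP   -- v7.2 glue (K-A′ = tree theorem)
  have hC : stub_gammaOneCover := gammaOneCover_of_cut h4 hD          -- v6 glue
  have hP : stub_gammaOneParity := gammaOneParity_of_cover hC hU   -- v4 glue
  dsimp only [stub_levelEqConductor] at h4
  exact starGO2SigmaLvl_of hP W W₀ f hf hf₀ hord ((h4 N) hf) L₀ hL₀ q hq hin hout x₀ hx₀ hnr lam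
    hlam hlam2 h℘ hβ

/-- **END STATE of line `kummer` (v7.4): the route item `StarGO2Sigma` (27046) from FOUR PRINTS** — Carayol (`stub_levelEqConductor`),
Rademacher's `log η` law (`stub_dedekindEtaLog`), Edixhoven ∧ Abbes–Ullmo (`stub_maninPrint`), Calegari–Dimitrov–Tang (`stub_ubd`);
every research stub is a tree theorem.  CONDITIONAL RESULT — the crux is NOT closed by this theorem. [cite: Stevens1982, §2.5] -/
theorem starGO2Sigma_of_prints (h4 : stub_levelEqConductor) (hKD : stub_dedekindEtaLog) (hMP : stub_maninPrint) (hU : stub_ubd) :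
    Summit.BirchSwinnertonDyer.BirchSwinnertonDyer.Theses.EisensteinDepletionAtTwo.StarGO2Sigma :=
  StarGO2Sigma_of h4 hKD KummerSigma.EtaSqrt.stub_etaSqrt hMP hU

/-! ### The split PARENT E1M_NSF (item 27021) WITHOUT Carayol -/

/-- COMPOSITION (kernel-checked, no sorry): stubs 1–3 and the sibling child `StarOptBNSF` (item 27047) give the split
parent `DepletedLambdaLawAtTwoModNSF` (item 27021) BY NAME — Carayol-free: the parent's modularity clause gives
`N = N_W` (TREE `IsNewformOf.level_eq_conductorNorm_of_exists_conductorLevel`), then the pointwise glue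
`depletedLambdaLawAtTwoAt_of_star` (p619642) exactly as in `depletedLambdaLawAtTwoModNSF_of_starNSF` (p622375).
[cite: GreenbergVatsal2000, §3 Thm. (3.12), display (28)] [cite: DiamondShurman2005, Thm. 8.8.1] -/
theorem DepletedLambdaLawAtTwoModNSF_of :
    stub_discrepancyCover → stub_ubd →
    Summit.BirchSwinnertonDyer.BirchSwinnertonDyer.Theses.EisensteinDepletionAtTwo.StarOptBNSF →
    Summit.BirchSwinnertonDyer.BirchSwinnertonDyer.Theses.EisensteinDepletionAtTwo.DepletedLambdaLawAtTwoModNSF := by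
  intro hD hU hO hMod W _ _ x hord hx hAB hnsf N _ f hf c L hL hι S hS hSN
  -- v6: Carayol for EVERY curve from the parent's modularity clause (strong multiplicity one, tree), so no print stub is used here
  have h4 : stub_levelEqConductor := fun N' _ V _ g hg ↦ by
    haveI : NeZero (V.conductorNorm ℤ) := ⟨(WeierstrassCurve.conductorNorm_pos_holds V).ne'⟩
    exact IsNewformOf.level_eq_conductorNorm_of_exists_conductorLevel (hMod V) hg
  have hP : stub_gammaOneParity := gammaOneParity_of_cover (gammaOneCover_of_cut h4 hD) hU
  have lvl := starGO2SigmaLvl_of hP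
  haveI : NeZero (W.conductorNorm ℤ) := ⟨(WeierstrassCurve.conductorNorm_pos_holds W).ne'⟩
  have hlevel : ∀ ⦃N' : ℕ⦄ [NeZero N'] (f' : CuspForm (Gamma0 N') 2), IsNewformOf W f' → N' = W.conductorNorm ℤ :=
    fun N' _ f' hf' ↦ IsNewformOf.level_eq_conductorNorm_of_exists_conductorLevel (hMod W) hf'
  exact depletedLambdaLawAtTwoAt_of_star W
    (fun W₀ _ _ N' _ f' hf' hf₀' hord' ↦ lvl W W₀ f' hf' hf₀' hord' (hlevel f' hf'))
    (fun x hord hx hAB h15 ↦ hO W x hord hx hAB h15 hnsf) x hord hx hAB f hf c L hL hι S hS hSN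

/-- **END STATE for the split parent E1M_NSF (27021)**: from the prints K-D, Manin, UBD and the sibling child `StarOptBNSF` (27047).
CONDITIONAL RESULT. [cite: GreenbergVatsal2000, §3 Thm. (3.12)] -/
theorem depletedLambdaLawAtTwoModNSF_of_prints (hKD : stub_dedekindEtaLog) (hMP : stub_maninPrint) (hU : stub_ubd)
    (hO : Summit.BirchSwinnertonDyer.BirchSwinnertonDyer.Theses.EisensteinDepletionAtTwo.StarOptBNSF) :
    Summit.BirchSwinnertonDyer.BirchSwinnertonDyer.Theses.EisensteinDepletionAtTwo.DepletedLambdaLawAtTwoModNSF :=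
  DepletedLambdaLawAtTwoModNSF_of (discrepancyCover_of_prints hKD hMP) hU hO

end Summit.BirchSwinnertonDyer.BirchSwinnertonDyer.Theorems.DepletionAtTwo.KummerDoor

end
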